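import Literature.IUT.LogVolume.TensorPacketOrbitVolume
import Literature.IUT.LogVolume.TensorPacketSlotTwists
import Mathlib.Algebra.Order.Floor.Defs
import HarnessLib

/-!
# Contents of NESTED slot-twists: the content of the last-slot twist exceeds the content of the slot union by the
# slot defect, to within one unit (tensor packets over any family of local fields; Dupuy–Hilado §3.7, §4.7, §4.12)

Proof-only file of the abc-iut cell (R2 S-chain seat abc-iut-s2-p2), part 1 of 3 of «reading (U) − reading (P) = the
(Ind1) slot residue» (parts 2–3: `GenuineLogThetaPerImageExactVolume.lean`, `GenuineLogThetaUnionPerImageResidue.lean`).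
Dupuy–Hilado, arXiv:2004.13228 [DupuyHilado2025] §3.7 (the slot embeddings `ι_a : k_a → ⊗_b k_b`), §4.7 ((Ind1) =
permutations of the tensor factors), §4.12 (hull, content w.r.t. the log-shell lattice `log_p(R_I^×)`); A. Weil, *Basic
Number Theory* [WeilBNT1967] Ch. II §2 Th. 2 (lattices); [IUTchIV] Thm. 1.10 Step (v) p. 27–28 for the context.

For nonzero `q_a ∈ k_a` (one per slot `a ∈ I`) write `M_a := ι_a(q_a)·(R_I)^∼`, `M_U := ⋃_a M_a` (the (Ind1)-slot union
of abc-iut-c312-3's `GenuineLogThetaExactVolume`) and fix a distinguished slot `b` (the last one in the application).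
The CONTENT of a bounded region `M ∌` only `0` is the integer `m` with `M ⊆ p^m·log_p(R_I^×)`, `M ⊄ p^{m+1}·log_p(R_I^×)`
(abc-iut-w5-d180 `exists_content` / `content_unique`). Using abc-iut-c312-d1's nesting of slot-twists by norm
(`iota_smul_normalizedPacket_subset_of_norm_le`, through the canonical decomposition `dEquiv`) and `ι_a(p^n·q)·(R_I)^∼ =
p^n·(ι_a(q)·(R_I)^∼)`:

* `content_anti` — content is antitone in the region;
* `iota_algebraMap_zpow_mul_smul_normalizedPacket`, `norm_algebraMap_zpow_mul`, `iota_smul_subset_zpow_smul_iota_smul`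
  (`‖q_b‖ ≤ p^{−n}‖q_a‖ ⇒ M_b ⊆ p^n·M_a`), `zpow_neg_smul_zpow_smul`;
* **`content_lastSlot_sub_slotUnion_ge`** — for contents `m_U` of `M_U` and `m_b` of `M_b` and EVERY slot `a`:
  `log‖q_a‖ − log‖q_b‖ − log p ≤ (m_b − m_U)·log p`;
* **`content_lastSlot_sub_slotUnion_le`** — if `a₀` carries the least divisible twist: `(m_b − m_U)·log p ≤ log‖q_{a₀}‖ − log‖q_b‖ + log p`;
* `content_lastSlot_eq_slotUnion_of_norm_eq` — all twists of the size of `q_b` ⇒ `m_b = m_U`.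
So `(m_b − m_U)·log p` is the slot defect `max_a log‖q_a‖ − log‖q_b‖` up to `± log p`. [cite: DupuyHilado2025, §3.7, §4.7, §4.12]
[cite: WeilBNT1967, Ch. II §2, Th. 2] [cite: Mochizuki2012, IUTchIV Thm. 1.10 Step (v) p. 27–28] (context only; the content
of this file is lattice algebra). PROOF-ONLY: no definitions; typed ≠ endorsed; no side taken on [IUTchIII] Cor. 3.12.
-/

noncomputable section

open Set Module
open scoped Pointwise TensorProduct

namespace Literature.IUT.LogVolume

/-! ## Contents of nested slot-twists (any family of local fields over `ℚ_p`) -/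

section Content

variable (p : ℕ) [Fact p.Prime]
variable {I : Type} [Fintype I] [DecidableEq I] [Nonempty I]
variable (k : I → Type) [∀ i, NontriviallyNormedField (k i)] [∀ i, NormedAlgebra ℚ_[p] (k i)]
  [∀ i, IsUltrametricDist (k i)] [∀ i, ProperSpace (k i)]

/-- **Content is antitone in the region**: if `M ⊆ M'`, `M ⊄ p^{m+1}·log_p(R_I^×)` and `M' ⊆ p^{m'}·log_p(R_I^×)` then
`m' ≤ m`. [cite: WeilBNT1967, Ch. II §2, Th. 2] -/
theorem content_anti {M M' : Set (PacketAlgebra p k)} {m m' : ℤ} (hMM' : M ⊆ M')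
    (hm1 : ¬ M ⊆ ((p : ℚ_[p]) ^ (m + 1)) • (logPacket p k : Set (PacketAlgebra p k)))
    (hm' : M' ⊆ ((p : ℚ_[p]) ^ m') • (logPacket p k : Set (PacketAlgebra p k))) : m' ≤ m := by
  by_contra h
  exact hm1 ((hMM'.trans hm').trans (zpow_smul_logPacket_anti p k (by omega)))

omit [Fintype I] [Nonempty I] [∀ i, IsUltrametricDist (k i)] [∀ i, ProperSpace (k i)] in
/-- **Scaling a slot-twist by a power of `p`**: `ι_a(p^n·q)·(R_I)^∼ = p^n·(ι_a(q)·(R_I)^∼)` (`ι_a` is a `ℚ_p`-algebra map).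
[cite: DupuyHilado2025, §3.7] -/
theorem iota_algebraMap_zpow_mul_smul_normalizedPacket (a : I) (q : k a) (n : ℤ) :
    iota p k a (algebraMap ℚ_[p] (k a) ((p : ℚ_[p]) ^ n) * q) •
        (normalizedPacket p k : Set (PacketAlgebra p k)) =
      ((p : ℚ_[p]) ^ n) • (iota p k a q • (normalizedPacket p k : Set (PacketAlgebra p k))) := by
  rw [map_mul, AlgHom.commutes, ← ppow_smul_set_eq, ppow, mul_smul]

omit [Fintype I] [DecidableEq I] [Nonempty I] [∀ i, IsUltrametricDist (k i)] [∀ i, ProperSpace (k i)] in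
/-- The norm of `p^n·q` in `k_a`: `‖p^n·q‖ = p^{−n}·‖q‖`. [cite: WeilBNT1967, Ch. II §2] -/
theorem norm_algebraMap_zpow_mul (a : I) (q : k a) (n : ℤ) :
    ‖algebraMap ℚ_[p] (k a) ((p : ℚ_[p]) ^ n) * q‖ = (p : ℝ) ^ (-n) * ‖q‖ := by
  rw [norm_mul, norm_algebraMap', Padic.norm_p_zpow]

/-- **Nested slot-twists, scaled**: if `‖q_b‖ ≤ p^{−n}·‖q_a‖` then `ι_b(q_b)·(R_I)^∼ ⊆ p^n·(ι_a(q_a)·(R_I)^∼)` — the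
ball of the more divisible twist lies in the `p^n`-multiple of the ball of the less divisible one (abc-iut-c312-d1's
`iota_smul_normalizedPacket_subset_of_norm_le` through the decomposition `ψ = dEquiv`). [cite: DupuyHilado2025, §3.7, §4.7] -/
theorem iota_smul_subset_zpow_smul_iota_smul (a b : I) {qa : k a} {qb : k b} (hqb : qb ≠ 0) (n : ℤ)
    (h : ‖qb‖ ≤ (p : ℝ) ^ (-n) * ‖qa‖) :
    iota p k b qb • (normalizedPacket p k : Set (PacketAlgebra p k)) ⊆
      ((p : ℚ_[p]) ^ n) • (iota p k a qa • (normalizedPacket p k : Set (PacketAlgebra p k))) := by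
  rw [← iota_algebraMap_zpow_mul_smul_normalizedPacket, ← norm_algebraMap_zpow_mul p k a qa n] at *
  exact iota_smul_normalizedPacket_subset_of_norm_le p k (DFac p k) (dEquiv p k) b a hqb h

omit [Fintype I] [DecidableEq I] [Nonempty I] [∀ i, IsUltrametricDist (k i)] [∀ i, ProperSpace (k i)] in
/-- `p^{−n}·(p^n·S) = S` for regions of the packet. [cite: WeilBNT1967, Ch. II §2] -/
theorem zpow_neg_smul_zpow_smul (n : ℤ) (S : Set (PacketAlgebra p k)) :
    ((p : ℚ_[p]) ^ (-n)) • (((p : ℚ_[p]) ^ n) • S) = S := by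
  have hp0 : (p : ℚ_[p]) ≠ 0 := Nat.cast_ne_zero.mpr (Fact.out : p.Prime).ne_zero
  rw [smul_smul, ← zpow_add₀ hp0, neg_add_cancel, zpow_zero, one_smul]

/-- **The content of the last-slot twist exceeds the content of the slot union by at least the floor of the slot
defect**: with `M_U = ⋃_a ι_a(q_a)·(R_I)^∼` of content `m_U` and `M_b = ι_b(q_b)·(R_I)^∼` of content `m_b`, for EVERY slot
`a`: `(m_b − m_U)·log p ≥ log‖q_a‖ − log‖q_b‖ − log p` (the integer `n = ⌊(log‖q_a‖ − log‖q_b‖)/log p⌋` has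
`M_b ⊆ p^n·M_a ⊆ p^{n+m_U}·log_p(R_I^×)`). [cite: DupuyHilado2025, §4.7, §4.12] [cite: WeilBNT1967, Ch. II §2, Th. 2] -/
theorem content_lastSlot_sub_slotUnion_ge (q : (a : I) → k a) (hq : ∀ a, q a ≠ 0) (b : I) {mU mb : ℤ}
    (hU : (⋃ a, iota p k a (q a) • (normalizedPacket p k : Set (PacketAlgebra p k))) ⊆
      ((p : ℚ_[p]) ^ mU) • (logPacket p k : Set (PacketAlgebra p k)))
    (hb1 : ¬ iota p k b (q b) • (normalizedPacket p k : Set (PacketAlgebra p k)) ⊆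
      ((p : ℚ_[p]) ^ (mb + 1)) • (logPacket p k : Set (PacketAlgebra p k)))
    (a : I) :
    Real.log ‖q a‖ - Real.log ‖q b‖ - Real.log p ≤ ((mb - mU : ℤ) : ℝ) * Real.log p := by
  have hp1 : (1 : ℝ) < p := by exact_mod_cast (Fact.out : p.Prime).one_lt
  have hlogp : 0 < Real.log (p : ℝ) := Real.log_pos hp1
  have hp0 : (p : ℚ_[p]) ≠ 0 := Nat.cast_ne_zero.mpr (Fact.out : p.Prime).ne_zero
  set D : ℝ := Real.log ‖q a‖ - Real.log ‖q b‖ with hD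
  set n : ℤ := ⌊D / Real.log p⌋ with hn
  -- `‖q_b‖ ≤ p^{-n}‖q_a‖` since `n·log p ≤ D`
  have hnle : (n : ℝ) * Real.log p ≤ D := by
    have := Int.floor_le (D / Real.log p)
    rw [← hn] at this
    calc (n : ℝ) * Real.log p ≤ D / Real.log p * Real.log p := mul_le_mul_of_nonneg_right this hlogp.le
      _ = D := div_mul_cancel₀ D hlogp.ne'
  have hnorm : ‖q b‖ ≤ (p : ℝ) ^ (-n) * ‖q a‖ := by
    have hqa : 0 < ‖q a‖ := norm_pos_iff.mpr (hq a)
    have hqb : 0 < ‖q b‖ := norm_pos_iff.mpr (hq b)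
    rw [← Real.log_le_log_iff hqb (by positivity), Real.log_mul (by positivity) hqa.ne', Real.log_zpow]
    push_cast
    linarith
  -- `M_b ⊆ p^n·M_a ⊆ p^n·M_U ⊆ p^{mU+n}·L`
  have hsub : iota p k b (q b) • (normalizedPacket p k : Set (PacketAlgebra p k)) ⊆
      ((p : ℚ_[p]) ^ (mU + n)) • (logPacket p k : Set (PacketAlgebra p k)) := by
    refine (iota_smul_subset_zpow_smul_iota_smul p k a b (hq b) n hnorm).trans ?_
    have hMa : iota p k a (q a) • (normalizedPacket p k : Set (PacketAlgebra p k)) ⊆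
        ((p : ℚ_[p]) ^ mU) • (logPacket p k : Set (PacketAlgebra p k)) :=
      (Set.subset_iUnion (fun a => iota p k a (q a) • (normalizedPacket p k : Set (PacketAlgebra p k))) a).trans hU
    refine (Set.smul_set_mono hMa).trans ?_
    rw [smul_smul, ← zpow_add₀ hp0, add_comm]
  -- content maximality of `mb`
  have hle : mU + n ≤ mb := content_anti p k Set.Subset.rfl hb1 hsub
  have hcast : ((mU + n : ℤ) : ℝ) ≤ ((mb : ℤ) : ℝ) := by exact_mod_cast hle
  push_cast at hcast ⊢
  -- `D − log p < n·log p ≤ (mb − mU)·log p`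
  have hlt : D - Real.log p < (n : ℝ) * Real.log p := by
    have := Int.lt_floor_add_one (D / Real.log p)
    rw [← hn] at this
    have h2 : D < ((n : ℝ) + 1) * Real.log p := by
      calc D = D / Real.log p * Real.log p := (div_mul_cancel₀ D hlogp.ne').symm
        _ < ((n : ℝ) + 1) * Real.log p := mul_lt_mul_of_pos_right this hlogp
    linarith
  nlinarith

/-- **… and by at most the ceiling of the slot defect**: if the slot `a₀` carries the LEAST divisible twist
(`‖q_a‖ ≤ ‖q_{a₀}‖` for all `a`), then `(m_b − m_U)·log p ≤ log‖q_{a₀}‖ − log‖q_b‖ + log p` (with `n = ⌈(log‖q_{a₀}‖ −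
log‖q_b‖)/log p⌉`: `M_U ⊆ M_{a₀}` and `p^n·M_{a₀} ⊆ M_b ⊆ p^{m_b}·log_p(R_I^×)`). [cite: DupuyHilado2025, §4.7, §4.12]
[cite: WeilBNT1967, Ch. II §2, Th. 2] -/
theorem content_lastSlot_sub_slotUnion_le (q : (a : I) → k a) (hq : ∀ a, q a ≠ 0) (b a₀ : I)
    (hmax : ∀ a, ‖q a‖ ≤ ‖q a₀‖) {mU mb : ℤ}
    (hU1 : ¬ (⋃ a, iota p k a (q a) • (normalizedPacket p k : Set (PacketAlgebra p k))) ⊆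
      ((p : ℚ_[p]) ^ (mU + 1)) • (logPacket p k : Set (PacketAlgebra p k)))
    (hb : iota p k b (q b) • (normalizedPacket p k : Set (PacketAlgebra p k)) ⊆
      ((p : ℚ_[p]) ^ mb) • (logPacket p k : Set (PacketAlgebra p k))) :
    ((mb - mU : ℤ) : ℝ) * Real.log p ≤ Real.log ‖q a₀‖ - Real.log ‖q b‖ + Real.log p := by
  have hp1 : (1 : ℝ) < p := by exact_mod_cast (Fact.out : p.Prime).one_lt
  have hlogp : 0 < Real.log (p : ℝ) := Real.log_pos hp1
  have hp0 : (p : ℚ_[p]) ≠ 0 := Nat.cast_ne_zero.mpr (Fact.out : p.Prime).ne_zero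
  set D : ℝ := Real.log ‖q a₀‖ - Real.log ‖q b‖ with hD
  set n : ℤ := ⌈D / Real.log p⌉ with hn
  -- `‖p^n q_{a₀}‖ ≤ ‖q_b‖` since `D ≤ n·log p`
  have hnge : D ≤ (n : ℝ) * Real.log p := by
    have := Int.le_ceil (D / Real.log p)
    rw [← hn] at this
    calc D = D / Real.log p * Real.log p := (div_mul_cancel₀ D hlogp.ne').symm
      _ ≤ (n : ℝ) * Real.log p := mul_le_mul_of_nonneg_right this hlogp.le
  have hnorm : ‖q a₀‖ ≤ (p : ℝ) ^ (-(-n)) * ‖q b‖ := by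
    have hqa : 0 < ‖q a₀‖ := norm_pos_iff.mpr (hq a₀)
    have hqb : 0 < ‖q b‖ := norm_pos_iff.mpr (hq b)
    rw [← Real.log_le_log_iff hqa (by positivity), Real.log_mul (by positivity) hqb.ne', Real.log_zpow]
    push_cast
    linarith
  -- `M_U ⊆ M_{a₀} ⊆ p^{-n}·M_b ⊆ p^{mb - n}·L`
  have hsub : (⋃ a, iota p k a (q a) • (normalizedPacket p k : Set (PacketAlgebra p k))) ⊆
      ((p : ℚ_[p]) ^ (mb - n)) • (logPacket p k : Set (PacketAlgebra p k)) := by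
    refine Set.iUnion_subset fun a => ?_
    refine (iota_smul_normalizedPacket_subset_of_norm_le p k (DFac p k) (dEquiv p k) a a₀ (hq a) (hmax a)).trans ?_
    refine (iota_smul_subset_zpow_smul_iota_smul p k b a₀ (hq a₀) (-n) hnorm).trans ?_
    refine (Set.smul_set_mono hb).trans ?_
    rw [smul_smul, ← zpow_add₀ hp0, neg_add_eq_sub]
  have hle : mb - n ≤ mU := content_anti p k Set.Subset.rfl hU1 hsub
  have hcast : ((mb - n : ℤ) : ℝ) ≤ ((mU : ℤ) : ℝ) := by exact_mod_cast hle
  push_cast at hcast ⊢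
  have hlt : (n : ℝ) * Real.log p < D + Real.log p := by
    have := Int.ceil_lt_add_one (D / Real.log p)
    rw [← hn] at this
    have h2 : (n : ℝ) * Real.log p < (D / Real.log p + 1) * Real.log p := mul_lt_mul_of_pos_right this hlogp
    rw [add_mul, div_mul_cancel₀ D hlogp.ne', one_mul] at h2
    exact h2
  nlinarith

/-- **No defect, no difference**: if every twist has the size of the last one (`‖q_a‖ = ‖q_b‖` for all `a`), the slot
union IS the last-slot twist and the two contents agree. [cite: DupuyHilado2025, §4.7] [cite: WeilBNT1967, Ch. II §2, Th. 2] -/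
theorem content_lastSlot_eq_slotUnion_of_norm_eq (q : (a : I) → k a) (hq : ∀ a, q a ≠ 0) (b : I)
    (hconst : ∀ a, ‖q a‖ = ‖q b‖) {mU mb : ℤ}
    (hU : (⋃ a, iota p k a (q a) • (normalizedPacket p k : Set (PacketAlgebra p k))) ⊆
      ((p : ℚ_[p]) ^ mU) • (logPacket p k : Set (PacketAlgebra p k)))
    (hU1 : ¬ (⋃ a, iota p k a (q a) • (normalizedPacket p k : Set (PacketAlgebra p k))) ⊆
      ((p : ℚ_[p]) ^ (mU + 1)) • (logPacket p k : Set (PacketAlgebra p k)))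
    (hb : iota p k b (q b) • (normalizedPacket p k : Set (PacketAlgebra p k)) ⊆
      ((p : ℚ_[p]) ^ mb) • (logPacket p k : Set (PacketAlgebra p k)))
    (hb1 : ¬ iota p k b (q b) • (normalizedPacket p k : Set (PacketAlgebra p k)) ⊆
      ((p : ℚ_[p]) ^ (mb + 1)) • (logPacket p k : Set (PacketAlgebra p k))) : mb = mU := by
  have heq : (⋃ a, iota p k a (q a) • (normalizedPacket p k : Set (PacketAlgebra p k))) =
      iota p k b (q b) • (normalizedPacket p k : Set (PacketAlgebra p k)) := by
    apply Set.Subset.antisymm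
    · exact Set.iUnion_subset fun a =>
        (iota_smul_normalizedPacket_eq_of_norm_eq p k (DFac p k) (dEquiv p k) a b (hq a) (hconst a)).le
    · exact Set.subset_iUnion (fun a => iota p k a (q a) • (normalizedPacket p k : Set (PacketAlgebra p k))) b
  rw [heq] at hU hU1
  exact content_unique p k hb hb1 hU hU1

end Content

end Literature.IUT.LogVolume

end
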